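import Literature.Analysis.Fourier.RadialSchwartzInterpolationGaussSupFormula
import Literature.Analysis.Fourier.RadialSchwartzInterpolationRepresentation
import Literature.Analysis.Fourier.RadialSchwartzInterpolationTruncation
import Mathlib.Analysis.Normed.Group.Tannery
import HarnessLib

/-!
# CKMRV interpolation, step 6: functional equations imply the interpolation formula

Sibling of `Literature/Analysis/Fourier/RadialSchwartzInterpolation.lean` (the named fact
`CKMRV2022_interpolationFormula` = Cohn–Kumar–Miller–Radchenko–Viazovska, Ann. Math. 196 (2022),
Theorem 1.7). This file assembles steps 1–5 into the **second half of CKMRV Theorem 3.1**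
("functional equations ⇒ interpolation formula", the dimension-free part of the proof of
Theorem 1.7), in the following proved form (`IsInterpolationBasis.of_functionalEquation`):

> Let `aₙ, bₙ, ãₙ, b̃ₙ` (`n ≥ n₀ ≥ 1`) be radial Schwartz functions on `ℝᵈ` whose values at
> every point grow at most polynomially in `n`, and whose generating functions (1.6)–(1.7)
> satisfy the functional equation (1.8), `F(τ,x) + (i/τ)^{d/2} F̃(−1/τ,x) = e^{πiτ|x|²}`, for all
> `τ ∈ ℍ` and `x ∈ ℝᵈ`. Then `(aₙ, bₙ, ãₙ, b̃ₙ)` is an interpolation basis: (1.4) holds for every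
> radial Schwartz `f`, the four series converging absolutely.

CKMRV prove this (with the generating functions extracted from `F`, and with seminorm growth)
via the continuity of the interpolation functional on `𝓢_rad(ℝᵈ)` and the density of complex
Gaussians (Lemma 2.2). Here the same route is made quantitative and density-free: radialTruncate
`f ↦ f_R = χ(|x|²/R²) f` (step 5), write `f_R` as a Gaussian superposition
`∫ w(t) e^{πi(2t+i)|x|²} dt` with `∫ (1+|t|)ᴷ|w| < ∞` (step 4), apply the interpolation formula
for superpositions (step 3, from (1.8) via steps 1–2), and let `R → ∞` by dominated convergence
of the four series (Schwartz decay of the data of `f`, uniform in `R`).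

What remains of CKMRV Theorem 1.7 after this file is exactly the modular-form input of §4–§5:
the existence, for `(d, n₀) = (8, 1)` and `(24, 2)`, of radial Schwartz families of polynomial
growth whose generating functions satisfy (1.8) (CKMRV Theorem 4.1 + §5 + the first half of
Theorem 3.1).

Everything is proved (theorems only); no named facts.

## References

* H. Cohn, A. Kumar, S. D. Miller, D. Radchenko, M. Viazovska, *Universal optimality of the `E₈`
  and Leech lattices and interpolation formulas*, Ann. of Math. 196 (2022) 983–1082,
  arXiv:1902.05438: §3.1 Theorem 3.1 and its proof; §2.3 Lemma 2.2. [CohnEtAl2019]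
-/

noncomputable section

open scoped Topology ContDiff FourierTransform SchwartzMap RealInnerProductSpace LineDeriv UpperHalfPlane
open Filter Set MeasureTheory Complex

namespace Literature.Analysis.Fourier

variable {d : ℕ} [NeZero d]


/-! ## Decay of the data of a Schwartz function at the nodes -/

/-- `‖e₀‖ = 1`. [folklore] -/
theorem norm_axisPt_one : ‖axisPt d 1‖ = 1 := by simp

/-- `(node n₀ n)^{2p} = (2(n₀+n))ᵖ ≥ (1+n)ᵖ` for `n₀ ≥ 1`. [folklore] -/
theorem one_add_pow_le_node_pow {n₀ : ℕ} (h : 1 ≤ n₀) (p n : ℕ) :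
    (1 + (n : ℝ)) ^ p ≤ node n₀ n ^ (2 * p) := by
  rw [pow_mul, node_sq]
  apply pow_le_pow_left₀ (by positivity)
  have : (1 : ℝ) ≤ n₀ := by exact_mod_cast h
  linarith [(Nat.cast_nonneg n : (0 : ℝ) ≤ n)]

/-- **Decay of the values at the nodes:** `‖f(√(2m) e₀)‖ ≤ p_{2p,0}(f)/(1+n)ᵖ`. [folklore] -/
theorem norm_radialValue_node_le {n₀ : ℕ} (h : 1 ≤ n₀) (f : 𝓢(EuclideanSpace ℝ (Fin d), ℂ)) (p n : ℕ) :
    ‖radialValue f (node n₀ n)‖ ≤ SchwartzMap.seminorm ℂ (2 * p) 0 f / (1 + (n : ℝ)) ^ p := by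
  have hpos : (0 : ℝ) < (1 + n) ^ p := by positivity
  rw [le_div_iff₀ hpos, mul_comm]
  have h1 := SchwartzMap.norm_pow_mul_le_seminorm ℂ f (2 * p) (axisPt d (node n₀ n))
  rw [norm_axisPt, abs_of_nonneg (node_nonneg _ _)] at h1
  exact (mul_le_mul_of_nonneg_right (one_add_pow_le_node_pow h p n) (norm_nonneg _)).trans h1

/-- `‖f′(r)‖ ≤ ‖Df(r e₀)‖ = ‖D¹f(r e₀)‖`. [folklore] -/
theorem norm_radialDeriv_le (f : 𝓢(EuclideanSpace ℝ (Fin d), ℂ)) (r : ℝ) :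
    ‖radialDeriv f r‖ ≤ ‖iteratedFDeriv ℝ 1 f (axisPt d r)‖ := by
  rw [radialDeriv_eq_fderiv f.differentiableAt, norm_iteratedFDeriv_one]
  calc ‖fderiv ℝ f (axisPt d r) (axisPt d 1)‖ ≤ ‖fderiv ℝ f (axisPt d r)‖ * ‖axisPt d 1‖ :=
        ContinuousLinearMap.le_opNorm _ _
    _ = ‖fderiv ℝ f (axisPt d r)‖ := by rw [norm_axisPt_one, mul_one]

/-- **Decay of the radial derivatives at the nodes:** `‖f′(√(2m))‖ ≤ p_{2p,1}(f)/(1+n)ᵖ`. [folklore] -/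
theorem norm_radialDeriv_node_le {n₀ : ℕ} (h : 1 ≤ n₀) (f : 𝓢(EuclideanSpace ℝ (Fin d), ℂ)) (p n : ℕ) :
    ‖radialDeriv f (node n₀ n)‖ ≤ SchwartzMap.seminorm ℂ (2 * p) 1 f / (1 + (n : ℝ)) ^ p := by
  have hpos : (0 : ℝ) < (1 + n) ^ p := by positivity
  rw [le_div_iff₀ hpos, mul_comm]
  have h1 := SchwartzMap.le_seminorm ℂ (2 * p) 1 f (axisPt d (node n₀ n))
  rw [norm_axisPt, abs_of_nonneg (node_nonneg _ _)] at h1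
  calc (1 + (n : ℝ)) ^ p * ‖radialDeriv f (node n₀ n)‖
      ≤ node n₀ n ^ (2 * p) * ‖iteratedFDeriv ℝ 1 f (axisPt d (node n₀ n))‖ :=
        mul_le_mul (one_add_pow_le_node_pow h p n) (norm_radialDeriv_le f _) (norm_nonneg _)
          (pow_nonneg (node_nonneg _ _) _)
    _ ≤ _ := h1

/-- A polynomially growing family against polynomially decaying data is absolutely summable:
`‖uₙ‖ ≤ A/(1+n)^{N+2}`, `‖cₙ‖ ≤ C(1+n)ᴺ` ⇒ `∑ ‖uₙ cₙ‖ < ∞`. [folklore] -/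
theorem summable_norm_mul_of_decay_of_growth {u c : ℕ → ℂ} {A C : ℝ} {N : ℕ}
    (hu : ∀ n, ‖u n‖ ≤ A / (1 + (n : ℝ)) ^ (N + 2)) (hc : ∀ n, ‖c n‖ ≤ C * (1 + n) ^ N) :
    Summable fun n => ‖u n * c n‖ := by
  have hA : 0 ≤ A := by
    have := hu 0
    simp only [Nat.cast_zero, add_zero, one_pow, div_one] at this
    exact le_trans (norm_nonneg _) this
  have hC : 0 ≤ C := le_trans (norm_nonneg _) (by simpa using hc 0)
  refine Summable.of_nonneg_of_le (fun n => norm_nonneg _) (fun n => ?_)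
    ((summable_one_div_one_add_sq.mul_left (A * C)))
  rw [norm_mul]
  have hpos : (0 : ℝ) < (1 + n) := by positivity
  calc ‖u n‖ * ‖c n‖ ≤ A / (1 + (n : ℝ)) ^ (N + 2) * (C * (1 + n) ^ N) :=
        mul_le_mul (hu n) (hc n) (norm_nonneg _) (by positivity)
    _ = A * C * (1 / (1 + (n : ℝ)) ^ 2) := by
        field_simp
        ring

/-- Real form: `∑ A/(1+n)^{N+2} · C(1+n)ᴺ < ∞`. [folklore] -/
theorem summable_decay_mul_growth (A C : ℝ) (N : ℕ) :
    Summable fun n : ℕ => A / (1 + (n : ℝ)) ^ (N + 2) * (C * (1 + n) ^ N) := by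
  refine (summable_one_div_one_add_sq.mul_left (A * C)).congr fun n => ?_
  have hpos : (0 : ℝ) < (1 + n) := by positivity
  field_simp
  ring

/-! ## Radial derivatives along the axis: general chain and product rules -/

/-- The derivative of the cut-off along the axis is bounded, uniformly in `R ≥ 1`. [folklore] -/
theorem exists_norm_deriv_radialCutoff_axis_le :
    ∃ M, 0 ≤ M ∧ ∀ R : ℝ, 1 ≤ R → ∀ r : ℝ,
      ‖deriv (fun t : ℝ => ((radialCutoff R (axisPt d t) : ℝ) : ℂ)) r‖ ≤ M := by
  obtain ⟨M, hM0, hM⟩ := exists_norm_iteratedFDeriv_radialCutoff_le (V := EuclideanSpace ℝ (Fin d)) 1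
  refine ⟨M, hM0, fun R hR r => ?_⟩
  have hdiff : DifferentiableAt ℝ (radialCutoff R : EuclideanSpace ℝ (Fin d) → ℝ) (axisPt d r) :=
    ((contDiff_radialCutoff R (n := 1)).differentiable (by simp)).differentiableAt
  have h0 : HasDerivAt (fun t : ℝ => radialCutoff R (axisPt d t))
      (fderiv ℝ (radialCutoff R) (axisPt d r) (axisPt d 1)) r := by
    simpa only [Function.comp_def] using hdiff.hasFDerivAt.comp_hasDerivAt r (hasDerivAt_axisPt r)
  have h1 := h0.ofReal_comp
  rw [h1.deriv, Complex.norm_real]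
  calc ‖fderiv ℝ (radialCutoff R) (axisPt d r) (axisPt d 1)‖
      ≤ ‖fderiv ℝ (radialCutoff R) (axisPt d r)‖ * ‖axisPt d 1‖ := ContinuousLinearMap.le_opNorm _ _
    _ = ‖iteratedFDeriv ℝ 1 (radialCutoff R) (axisPt d r)‖ := by
      rw [norm_axisPt_one, mul_one, norm_iteratedFDeriv_one]
    _ ≤ M := hM R hR _

/-- **Product rule for the radial derivative of a truncation:**
`(f_R)′(r) = (χ_R ∘ axis)′(r) f(r e₀) + χ_R(r e₀) f′(r)`. [folklore] -/
theorem radialDeriv_radialTruncate (R : ℝ) (f : 𝓢(EuclideanSpace ℝ (Fin d), ℂ)) (r : ℝ) :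
    radialDeriv (radialTruncate R f) r =
      deriv (fun t : ℝ => ((radialCutoff R (axisPt d t) : ℝ) : ℂ)) r * f (axisPt d r) +
        ((radialCutoff R (axisPt d r) : ℝ) : ℂ) * radialDeriv f r := by
  have hdiff : DifferentiableAt ℝ (radialCutoff R : EuclideanSpace ℝ (Fin d) → ℝ) (axisPt d r) :=
    ((contDiff_radialCutoff R (n := 1)).differentiable (by simp)).differentiableAt
  have h0 : HasDerivAt (fun t : ℝ => radialCutoff R (axisPt d t))
      (fderiv ℝ (radialCutoff R) (axisPt d r) (axisPt d 1)) r := by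
    simpa only [Function.comp_def] using hdiff.hasFDerivAt.comp_hasDerivAt r (hasDerivAt_axisPt r)
  have hc := h0.ofReal_comp
  have hf : HasDerivAt (fun t : ℝ => f (axisPt d t)) (fderiv ℝ f (axisPt d r) (axisPt d 1)) r := by
    simpa only [Function.comp_def] using
      f.differentiableAt.hasFDerivAt.comp_hasDerivAt r (hasDerivAt_axisPt r)
  have h : HasDerivAt (fun t : ℝ => ((radialCutoff R (axisPt d t) : ℝ) : ℂ) * f (axisPt d t))
      (((fderiv ℝ (radialCutoff R) (axisPt d r) (axisPt d 1) : ℝ) : ℂ) * f (axisPt d r) +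
        ((radialCutoff R (axisPt d r) : ℝ) : ℂ) * fderiv ℝ f (axisPt d r) (axisPt d 1)) r :=
    hc.mul hf
  rw [radialDeriv_def, coe_radialTruncate]
  show deriv (fun t : ℝ => ((radialCutoff R (axisPt d t) : ℝ) : ℂ) * f (axisPt d t)) r = _
  rw [h.deriv, hc.deriv, radialDeriv_def, hf.deriv]

/-- **Uniform bound for the radial derivatives of the truncations:**
`‖(f_R)′(r)‖ ≤ M ‖f(r e₀)‖ + ‖f′(r)‖` for all `R ≥ 1`. [folklore] -/
theorem exists_norm_radialDeriv_radialTruncate_le (f : 𝓢(EuclideanSpace ℝ (Fin d), ℂ)) :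
    ∃ M, 0 ≤ M ∧ ∀ R : ℝ, 1 ≤ R → ∀ r : ℝ,
      ‖radialDeriv (radialTruncate R f) r‖ ≤ M * ‖f (axisPt d r)‖ + ‖radialDeriv f r‖ := by
  obtain ⟨M, hM0, hM⟩ := exists_norm_deriv_radialCutoff_axis_le (d := d)
  refine ⟨M, hM0, fun R hR r => ?_⟩
  rw [radialDeriv_radialTruncate]
  refine (norm_add_le _ _).trans (add_le_add ?_ ?_)
  · rw [norm_mul]
    exact mul_le_mul_of_nonneg_right (hM R hR r) (norm_nonneg _)
  · rw [norm_mul, Complex.norm_real, Real.norm_eq_abs]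
    exact mul_le_of_le_one_left (norm_nonneg _) (abs_radialCutoff_le_one R _)

/-- For fixed `r`, `f_R(r) = f(r)` and `(f_R)′(r) = f′(r)` for all large `R` (the truncation
agrees with `f` near `r e₀`). [folklore] -/
theorem eventually_radial_radialTruncate_eq (f : 𝓢(EuclideanSpace ℝ (Fin d), ℂ)) (r : ℝ) :
    ∀ᶠ R : ℝ in atTop, radialValue (radialTruncate R f) r = radialValue f r ∧
      radialDeriv (radialTruncate R f) r = radialDeriv f r := by
  filter_upwards [eventually_gt_atTop (|r| + 1), eventually_ge_atTop (1 : ℝ)] with R hR hR1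
  have hR0 : 0 < R := by linarith
  have hev : (fun t : ℝ => radialTruncate R f (axisPt d t)) =ᶠ[𝓝 r] fun t : ℝ => f (axisPt d t) := by
    have hmem : Ioo (-(|r| + 1)) (|r| + 1) ∈ 𝓝 r :=
      Ioo_mem_nhds (by linarith [neg_abs_le r]) (by linarith [le_abs_self r])
    filter_upwards [hmem] with t ht
    apply radialTruncate_apply_of_norm_le hR0
    rw [norm_axisPt]
    have : |t| < |r| + 1 := abs_lt.2 ⟨ht.1, ht.2⟩
    linarith
  exact ⟨hev.eq_of_nhds, by rw [radialDeriv_def, radialDeriv_def, hev.deriv_eq]⟩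

/-! ## The Fourier side: radial derivatives of `𝓕 g` as Fourier transforms -/

/-- The multiplier `−2πi⟨x, e₀⟩` turning `𝓕` into a radial derivative: `W g = −2πi ⟨·, e₀⟩ g`.
[folklore] -/
theorem radialDeriv_fourier_eq (g : 𝓢(EuclideanSpace ℝ (Fin d), ℂ)) (r : ℝ) :
    radialDeriv ((𝓕 g : 𝓢(EuclideanSpace ℝ (Fin d), ℂ)) : EuclideanSpace ℝ (Fin d) → ℂ) r =
      (𝓕 (-(2 * Real.pi * Complex.I) • SchwartzMap.smulLeftCLM ℂ (inner ℝ · (axisPt d 1)) g) :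
        𝓢(EuclideanSpace ℝ (Fin d), ℂ)) (axisPt d r) := by
  rw [radialDeriv_eq_fderiv (𝓕 g).differentiableAt, ← SchwartzMap.lineDerivOp_apply_eq_fderiv,
    SchwartzMap.lineDerivOp_fourier_eq]

/-- The multiplier `W` commutes with truncation. [folklore] -/
theorem smulLeftCLM_inner_radialTruncate (R : ℝ) (g : 𝓢(EuclideanSpace ℝ (Fin d), ℂ)) :
    (-(2 * Real.pi * Complex.I) • SchwartzMap.smulLeftCLM ℂ (inner ℝ · (axisPt d 1)) (radialTruncate R g)) =
      radialTruncate R (-(2 * Real.pi * Complex.I) • SchwartzMap.smulLeftCLM ℂ (inner ℝ · (axisPt d 1)) g) := by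
  have hT : (fun x : EuclideanSpace ℝ (Fin d) => inner ℝ x (axisPt d 1)).HasTemperateGrowth :=
    Function.hasTemperateGrowth_inner_left (axisPt d 1)
  ext x
  simp only [smul_apply, SchwartzMap.smulLeftCLM_apply_apply hT, radialTruncate_apply,
    Complex.real_smul, smul_eq_mul]
  ring

/-- **Decay of the Fourier data of the truncations, uniformly in `R ≥ 1`:** for a Schwartz `g`
and `p` there is `A` with `‖(𝓕 g_R)(r e₀)‖ ≤ A/(1+n)ᵖ` at the nodes, all `R ≥ 1`. [folklore] -/
theorem exists_norm_fourier_radialTruncate_node_le {n₀ : ℕ} (h : 1 ≤ n₀) (g : 𝓢(EuclideanSpace ℝ (Fin d), ℂ))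
    (p : ℕ) :
    ∃ A, ∀ R : ℝ, 1 ≤ R → ∀ n : ℕ,
      ‖(𝓕 (radialTruncate R g) : 𝓢(EuclideanSpace ℝ (Fin d), ℂ)) (axisPt d (node n₀ n))‖ ≤
        A / (1 + (n : ℝ)) ^ p := by
  obtain ⟨A, hA0, hA⟩ := exists_one_add_norm_pow_mul_norm_fourier_radialTruncate_le g (2 * p)
  refine ⟨A, fun R hR n => ?_⟩
  have hpos : (0 : ℝ) < (1 + n) ^ p := by positivity
  rw [le_div_iff₀ hpos, mul_comm]
  have h1 := hA R hR (axisPt d (node n₀ n))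
  rw [norm_axisPt, abs_of_nonneg (node_nonneg _ _)] at h1
  refine le_trans (mul_le_mul_of_nonneg_right ?_ (norm_nonneg _)) h1
  calc (1 + (n : ℝ)) ^ p ≤ node n₀ n ^ (2 * p) := one_add_pow_le_node_pow h p n
    _ ≤ (1 + node n₀ n) ^ (2 * p) :=
        pow_le_pow_left₀ (node_nonneg _ _) (by linarith [node_nonneg n₀ n]) _

/-! ## The theorem -/

/-- **Functional equations imply the interpolation formula** (the second half of CKMRV
Theorem 3.1, dimension-free, in density-free quantitative form). Let `aₙ, bₙ, ãₙ, b̃ₙ`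
(`n ≥ n₀ ≥ 1`, enumerated as `n₀ + n`) be radial Schwartz functions on `ℝᵈ` such that
(i) for every `x` the values `|aₙ(x)|, |bₙ(x)|, |ãₙ(x)|, |b̃ₙ(x)|` grow at most polynomially in
`n`, and (ii) the generating functions (1.6)–(1.7) satisfy the functional equation (1.8)
`F(τ,x) + (i/τ)^{d/2} F̃(−1/τ,x) = e^{πiτ|x|²}` for all `τ ∈ ℍ`, `x ∈ ℝᵈ`. Then they form an
interpolation basis: for every radial Schwartz `f` and every `x`,
`f(x) = ∑ f(√(2m)) aₘ(x) + ∑ f′(√(2m)) bₘ(x) + ∑ f̂(√(2m)) ãₘ(x) + ∑ f̂′(√(2m)) b̃ₘ(x)`,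
each series converging absolutely (CKMRV: "Thus, the interpolation formula holds for all radial
Schwartz functions, as desired"). [cite: CohnEtAl2019, §3.1 Theorem 3.1 (proof)] -/
theorem IsInterpolationBasis.of_functionalEquation {n₀ : ℕ} (hn₀ : 1 ≤ n₀)
    {a b a' b' : ℕ → 𝓢(EuclideanSpace ℝ (Fin d), ℂ)}
    (ha : ∀ n, IsRadial (a n)) (hb : ∀ n, IsRadial (b n)) (ha' : ∀ n, IsRadial (a' n))
    (hb' : ∀ n, IsRadial (b' n))
    (hgrowth : ∀ x : EuclideanSpace ℝ (Fin d), ∃ (C : ℝ) (N : ℕ), ∀ n, ‖a n x‖ ≤ C * (1 + n) ^ N ∧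
      ‖b n x‖ ≤ C * (1 + n) ^ N ∧ ‖a' n x‖ ≤ C * (1 + n) ^ N ∧ ‖b' n x‖ ≤ C * (1 + n) ^ N)
    (hFE : ∀ (τ : ℍ) (x : EuclideanSpace ℝ (Fin d)), genFun n₀ (fun n => ⇑(a n)) (fun n => ⇑(b n)) τ x +
      (I / (τ : ℂ)) ^ ((d : ℂ) / 2) * genFun n₀ (fun n => ⇑(a' n)) (fun n => ⇑(b' n)) (-(τ : ℂ)⁻¹) x =
        cexp (Real.pi * I * (τ : ℂ) * ‖x‖ ^ 2)) :
    IsInterpolationBasis d n₀ a b a' b' := by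
  -- absolute convergence of the four series, for every Schwartz `f`
  have hsum : ∀ (f : 𝓢(EuclideanSpace ℝ (Fin d), ℂ)) (x : EuclideanSpace ℝ (Fin d)),
      (Summable fun n => ‖radialValue f (node n₀ n) * a n x‖) ∧
      (Summable fun n => ‖radialDeriv f (node n₀ n) * b n x‖) ∧
      (Summable fun n => ‖radialValue (𝓕 f : 𝓢(EuclideanSpace ℝ (Fin d), ℂ)) (node n₀ n) * a' n x‖) ∧
      (Summable fun n => ‖radialDeriv (𝓕 f : 𝓢(EuclideanSpace ℝ (Fin d), ℂ)) (node n₀ n) * b' n x‖) := by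
    intro f x
    obtain ⟨C, N, hCN⟩ := hgrowth x
    exact ⟨summable_norm_mul_of_decay_of_growth (norm_radialValue_node_le hn₀ f (N + 2))
        (fun n => (hCN n).1),
      summable_norm_mul_of_decay_of_growth (norm_radialDeriv_node_le hn₀ f (N + 2))
        (fun n => (hCN n).2.1),
      summable_norm_mul_of_decay_of_growth (norm_radialValue_node_le hn₀ (𝓕 f) (N + 2))
        (fun n => (hCN n).2.2.1),
      summable_norm_mul_of_decay_of_growth (norm_radialDeriv_node_le hn₀ (𝓕 f) (N + 2))
        (fun n => (hCN n).2.2.2)⟩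
  refine ⟨ha, hb, ha', hb', fun f _ x => (hsum f x).1, fun f _ x => (hsum f x).2.1,
    fun f _ x => (hsum f x).2.2.1, fun f _ x => (hsum f x).2.2.2, ?_⟩
  intro f hf x₀
  obtain ⟨C, N, hCN⟩ := hgrowth x₀
  have hC : 0 ≤ C := le_trans (norm_nonneg _) (by simpa using (hCN 0).1)
  -- the multiplier turning `𝓕` into a radial derivative
  set W : 𝓢(EuclideanSpace ℝ (Fin d), ℂ) → 𝓢(EuclideanSpace ℝ (Fin d), ℂ) := fun g =>
    -(2 * Real.pi * Complex.I) • SchwartzMap.smulLeftCLM ℂ (inner ℝ · (axisPt d 1)) g with hW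
  -- Step 1: the interpolation formula for the truncations `f_R`, `R ≥ 1`
  have hformula : ∀ R : ℝ, 1 ≤ R → radialTruncate R f x₀ =
      (∑' n, radialValue (radialTruncate R f) (node n₀ n) * a n x₀) +
      (∑' n, radialDeriv (radialTruncate R f) (node n₀ n) * b n x₀) +
      (∑' n, radialValue (𝓕 (radialTruncate R f) : 𝓢(EuclideanSpace ℝ (Fin d), ℂ)) (node n₀ n) * a' n x₀) +
      (∑' n, radialDeriv (𝓕 (radialTruncate R f) : 𝓢(EuclideanSpace ℝ (Fin d), ℂ)) (node n₀ n) * b' n x₀) := by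
    intro R hR1
    have hR0 : 0 < R := by linarith
    obtain ⟨w, hw, hwK, hrepr⟩ := exists_gaussSup_eq (radialTruncate R f) (isRadial_radialTruncate R hf)
      (R := 2 * R) (by linarith) (fun x hx => radialTruncate_apply_of_two_mul_le hR0 f hx) 1
      (2 * (N + 3))
    have hfun : (⇑(radialTruncate R f) : EuclideanSpace ℝ (Fin d) → ℂ) = gaussSup w 1 := funext hrepr
    have hFE1 : ∀ t : ℝ, genFun n₀ (fun n => ⇑(a n)) (fun n => ⇑(b n)) (lineH 1 t) x₀ +
        (I / lineH 1 t) ^ ((d : ℂ) / 2) *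
          genFun n₀ (fun n => ⇑(a' n)) (fun n => ⇑(b' n)) (-(lineH 1 t)⁻¹) x₀ =
        cexp (Real.pi * I * lineH 1 t * ‖x₀‖ ^ 2) := fun t => hFE (lineHPt 1 one_pos t) x₀
    have h := (gaussSup_eq_interpolationSum hn₀ (fun n => ⇑(a n)) (fun n => ⇑(b n))
      (fun n => ⇑(a' n)) (fun n => ⇑(b' n)) x₀ (fun n => (hCN n).1) (fun n => (hCN n).2.1)
      (fun n => (hCN n).2.2.1) (fun n => (hCN n).2.2.2) one_pos hFE1 hw hwK).2.2.2.2
    rw [← hfun, ← SchwartzMap.fourier_coe] at h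
    exact h
  -- Step 2: limits as `R → ∞`
  -- (0) the left-hand side
  have hL0 : Tendsto (fun R : ℝ => radialTruncate R f x₀) atTop (𝓝 (f x₀)) :=
    tendsto_const_nhds.congr' (by
      filter_upwards [eventually_radialTruncate_apply_eq f x₀] with R hR using hR.symm)
  -- (1) values
  have hL1 : Tendsto (fun R : ℝ => ∑' n, radialValue (radialTruncate R f) (node n₀ n) * a n x₀) atTop
      (𝓝 (∑' n, radialValue f (node n₀ n) * a n x₀)) := by
    refine tendsto_tsum_of_dominated_convergence
      (summable_decay_mul_growth (SchwartzMap.seminorm ℂ (2 * (N + 2)) 0 f) C N)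
      (fun n => tendsto_const_nhds.congr' ?_) (Eventually.of_forall fun R n => ?_)
    · filter_upwards [eventually_radial_radialTruncate_eq f (node n₀ n)] with R hR
      rw [hR.1]
    · rw [norm_mul]
      refine mul_le_mul ?_ (hCN n).1 (norm_nonneg _) (by positivity)
      exact (norm_radialTruncate_apply_le R f _).trans (norm_radialValue_node_le hn₀ f (N + 2) n)
  -- (2) radial derivatives
  obtain ⟨M, hM0, hM⟩ := exists_norm_radialDeriv_radialTruncate_le f (d := d)
  have hL2 : Tendsto (fun R : ℝ => ∑' n, radialDeriv (radialTruncate R f) (node n₀ n) * b n x₀) atTop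
      (𝓝 (∑' n, radialDeriv f (node n₀ n) * b n x₀)) := by
    refine tendsto_tsum_of_dominated_convergence
      (summable_decay_mul_growth (M * SchwartzMap.seminorm ℂ (2 * (N + 2)) 0 f +
        SchwartzMap.seminorm ℂ (2 * (N + 2)) 1 f) C N)
      (fun n => tendsto_const_nhds.congr' ?_) ?_
    · filter_upwards [eventually_radial_radialTruncate_eq f (node n₀ n)] with R hR
      rw [hR.2]
    · filter_upwards [eventually_ge_atTop (1 : ℝ)] with R hR n
      rw [norm_mul]
      refine mul_le_mul ?_ (hCN n).2.1 (norm_nonneg _) (by positivity)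
      refine (hM R hR _).trans ?_
      rw [add_div, mul_div_assoc]
      exact add_le_add (mul_le_mul_of_nonneg_left (norm_radialValue_node_le hn₀ f (N + 2) n) hM0)
        (norm_radialDeriv_node_le hn₀ f (N + 2) n)
  -- (3) Fourier values
  obtain ⟨A₃, hA₃⟩ := exists_norm_fourier_radialTruncate_node_le hn₀ f (N + 2) (d := d)
  have hL3 : Tendsto (fun R : ℝ =>
      ∑' n, radialValue (𝓕 (radialTruncate R f) : 𝓢(EuclideanSpace ℝ (Fin d), ℂ)) (node n₀ n) * a' n x₀) atTop
      (𝓝 (∑' n, radialValue (𝓕 f : 𝓢(EuclideanSpace ℝ (Fin d), ℂ)) (node n₀ n) * a' n x₀)) := by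
    refine tendsto_tsum_of_dominated_convergence (summable_decay_mul_growth A₃ C N)
      (fun n => ((tendsto_fourier_radialTruncate f (axisPt d (node n₀ n))).mul_const (a' n x₀)).congr
        fun R => rfl) ?_
    filter_upwards [eventually_ge_atTop (1 : ℝ)] with R hR n
    rw [norm_mul]
    exact mul_le_mul (hA₃ R hR n) (hCN n).2.2.1 (norm_nonneg _) (by
      have := hA₃ 1 le_rfl 0
      have hA : 0 ≤ A₃ := le_trans (norm_nonneg _) (by simpa using this)
      positivity)
  -- (4) Fourier radial derivatives, via the multiplier `W`
  obtain ⟨A₄, hA₄⟩ := exists_norm_fourier_radialTruncate_node_le hn₀ (W f) (N + 2) (d := d)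
  have hW4 : ∀ (g : 𝓢(EuclideanSpace ℝ (Fin d), ℂ)) (r : ℝ),
      radialDeriv ((𝓕 g : 𝓢(EuclideanSpace ℝ (Fin d), ℂ)) : EuclideanSpace ℝ (Fin d) → ℂ) r =
      (𝓕 (W g) : 𝓢(EuclideanSpace ℝ (Fin d), ℂ)) (axisPt d r) := fun g r => radialDeriv_fourier_eq g r
  have hWT : ∀ R : ℝ, W (radialTruncate R f) = radialTruncate R (W f) := fun R =>
    smulLeftCLM_inner_radialTruncate R f
  have hL4 : Tendsto (fun R : ℝ =>
      ∑' n, radialDeriv (𝓕 (radialTruncate R f) : 𝓢(EuclideanSpace ℝ (Fin d), ℂ)) (node n₀ n) * b' n x₀) atTop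
      (𝓝 (∑' n, radialDeriv (𝓕 f : 𝓢(EuclideanSpace ℝ (Fin d), ℂ)) (node n₀ n) * b' n x₀)) := by
    simp only [hW4, hWT]
    refine tendsto_tsum_of_dominated_convergence (summable_decay_mul_growth A₄ C N)
      (fun n => ((tendsto_fourier_radialTruncate (W f) (axisPt d (node n₀ n))).mul_const (b' n x₀)).congr
        fun R => rfl) ?_
    filter_upwards [eventually_ge_atTop (1 : ℝ)] with R hR n
    rw [norm_mul]
    exact mul_le_mul (hA₄ R hR n) (hCN n).2.2.2 (norm_nonneg _) (by
      have := hA₄ 1 le_rfl 0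
      have hA : 0 ≤ A₄ := le_trans (norm_nonneg _) (by simpa using this)
      positivity)
  -- conclusion: both sides of the truncated formula converge
  exact tendsto_nhds_unique_of_eventuallyEq hL0 (((hL1.add hL2).add hL3).add hL4)
    (by filter_upwards [eventually_ge_atTop (1 : ℝ)] with R hR using hformula R hR)

end Literature.Analysis.Fourier
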